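/-
Origin: expansion seat `planner-pub-hodgecm-pv13-0`, handover 2026-08-18T03:52:02Z (`HOME/pub-hodgecm-pv13/lean/Pv13/SchurUnitary.lean`, md5 a3022465, 387 lines);
landed by the gen-5 packager in gate run 20 as `HodgeCM/PerL34/SchurUnitary.lean` (verbatim).
-/
/-
Origin: pub-hodgecm-pv13 (DAG-NODE PROVER #13), toward node N31h (ii) (PerL v5 ll. 633–635, "every
irreducible constituent of the closure of π_i has archimedean component J⁺ ⊗ 𝟏").  MATHLIB ONLY.
Proposed place: `HodgeCM/PerL34/SchurUnitary.lean`, namespace `HodgeCM.PerL34.Schur`.  Nothing cited,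
nothing asserted: every statement below is kernel-proved from Mathlib.
-/
import Mathlib.Analysis.CStarAlgebra.ContinuousLinearMap
import Mathlib.Analysis.CStarAlgebra.ContinuousFunctionalCalculus.Basic
import Mathlib.Analysis.CStarAlgebra.ContinuousFunctionalCalculus.Instances
import Mathlib.Analysis.CStarAlgebra.ContinuousFunctionalCalculus.Commute
import Mathlib.Analysis.InnerProductSpace.Adjoint

set_option autoImplicit false

/-!
# Topological Schur lemma for irreducible unitary representations (kernel half of N31h (ii))

The constituent step of PerL v5 Lemma 4.2(b), ll. 633–635, as certified by the adversarial readers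
(GAPS.md adv2-C3: "a non-zero continuous `G_b`-intertwiner from … an irreducible unitary representation into
a multiple of an irreducible unitary `σ_b` forces `σ_b ≅ V_{χ̄′_b}`"), rests on two inputs:
(print) the irreducibility / identification of the `U(1)`-isotypic pieces of the oscillator representation
(Borel–Wallach, 2nd ed., VIII 2.10, 2.11, 2.14; VI Thm 4.11; VII Prop 4.11), and
(kernel) **Schur's lemma for topologically irreducible unitary representations on Hilbert spaces** and its
corollary on intertwiners.  Mathlib has Schur's lemma only for (finite-dimensional / algebraic)
representations; this file proves the Hilbert-space version from the continuous functional calculus: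

* `Schur.eq_scalar_of_commute` — if a family `S` of bounded operators on a complex Hilbert space is closed
  under adjoints and topologically irreducible (no closed invariant subspace other than `⊥`, `⊤`), every bounded
  operator commuting with `S` is a scalar;
* `Schur.norm_sq_eq_of_intertwiner` — a bounded intertwiner `T` from an irreducible unitary representation
  `ρ` to a unitary representation `σ` satisfies `‖T x‖² = c ‖x‖²` for a constant `c ≥ 0`;
* `Schur.exists_equiv_of_intertwiner_ne_zero` — if moreover `σ` is irreducible and `T ≠ 0`, then `ρ` and
  `σ` are unitarily equivalent (an intertwining `LinearIsometryEquiv`);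
* `Schur.exists_isometry_of_intertwiner_ne_zero` — without irreducibility of `σ`: `ρ` embeds isometrically
  and equivariantly onto a closed invariant subspace of `σ` (i.e. `ρ` IS a constituent of `σ`).

Proof of the first: for self-adjoint `B` commuting with `S`, if `spectrum ℝ B` had two points `λ ≠ μ`,
bump functions `f, g` with `f g = 0`, `f(λ) ≠ 0 ≠ g(μ)` give non-zero `F = f(B)`, `G = g(B)` commuting with
`S` with `F G = 0`; the closure of `range F` is then a closed invariant subspace, non-zero, and proper
(because `G` kills it) — contradiction; so the spectrum is one point and `B` is a scalar
(`CFC.eq_algebraMap_of_spectrum_subset_singleton`); a general `A` is `(B₁ + i B₂)/2` with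
`B₁ = A + A*`, `B₂ = i(A* − A)` self-adjoint and commuting with `S` (this is where `S = S*` is used).
-/

noncomputable section

open scoped InnerProductSpace ComplexConjugate
open ContinuousLinearMap

namespace HodgeCM
namespace PerL34
namespace Schur

section Operators

variable {H : Type*} [NormedAddCommGroup H] [InnerProductSpace ℂ H] [CompleteSpace H]

/-- `K` is invariant under every operator of the family `S`. -/
def Invariant (S : Set (H →L[ℂ] H)) (K : Submodule ℂ H) : Prop :=
  ∀ s ∈ S, ∀ x ∈ K, s x ∈ K

/-- **Topological irreducibility** of a family of bounded operators: the only CLOSED invariant subspaces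
are `⊥` and `⊤`. -/
def TopIrreducible (S : Set (H →L[ℂ] H)) : Prop :=
  ∀ K : Submodule ℂ H, IsClosed (K : Set H) → Invariant S K → K = ⊥ ∨ K = ⊤

omit [CompleteSpace H] in
/-- The closure of the range of an operator commuting with `S` is `S`-invariant. -/
theorem invariant_closure_range {S : Set (H →L[ℂ] H)} (F : H →L[ℂ] H)
    (hF : ∀ s ∈ S, Commute s F) :
    Invariant S (LinearMap.range F.toLinearMap).topologicalClosure := by
  intro s hs x hx
  have hmaps : Set.MapsTo (s : H → H) (LinearMap.range F.toLinearMap : Set H)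
      (LinearMap.range F.toLinearMap : Set H) := by
    rintro _ ⟨z, rfl⟩
    refine ⟨s z, ?_⟩
    have h := congrArg (fun T : H →L[ℂ] H => T z) (hF s hs).eq
    simpa using h.symm
  have hx' : x ∈ closure (LinearMap.range F.toLinearMap : Set H) := by
    rw [← Submodule.topologicalClosure_coe]; exact hx
  have := map_mem_closure s.continuous hx' hmaps
  rw [← Submodule.topologicalClosure_coe] at this
  exact this

/-- A continuous "tent" function: `tent a r x = max 0 (r − |x − a|)`. -/
def tent (a r : ℝ) (x : ℝ) : ℝ := max 0 (r - |x - a|)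

/-- (Ported verbatim from the HodgeCMPerL package; no docstring in the source.) -/
theorem tent_continuous (a r : ℝ) : Continuous (tent a r) := by
  unfold tent
  exact continuous_const.max (continuous_const.sub ((continuous_id.sub continuous_const).abs))

/-- (Ported verbatim from the HodgeCMPerL package; no docstring in the source.) -/
theorem tent_self (a : ℝ) {r : ℝ} (hr : 0 ≤ r) : tent a r a = r := by
  simp [tent, hr]

/-- (Ported verbatim from the HodgeCMPerL package; no docstring in the source.) -/
theorem tent_eq_zero {a r x : ℝ} (h : r ≤ |x - a|) : tent a r x = 0 := by
  simp only [tent, max_eq_left_iff, sub_nonpos]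
  exact h

/-- Two tents of radius `|a − b|/3` around `a ≠ b` have disjoint supports. -/
theorem tent_mul_tent (a b x : ℝ) : tent a (|a - b| / 3) x * tent b (|a - b| / 3) x = 0 := by
  by_cases h1 : |a - b| / 3 ≤ |x - a|
  · rw [tent_eq_zero h1, zero_mul]
  · have h2 : |a - b| / 3 ≤ |x - b| := by
      by_contra h2
      push Not at h1 h2
      have h3 : |a - b| ≤ |x - a| + |x - b| := by
        calc |a - b| = |(a - x) + (x - b)| := by ring_nf
          _ ≤ |a - x| + |x - b| := abs_add_le _ _
          _ = |x - a| + |x - b| := by rw [abs_sub_comm a x]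
      have h4 : 0 ≤ |a - b| := abs_nonneg _
      linarith
    rw [tent_eq_zero h2, mul_zero]

variable [Nontrivial H]

/-- (Ported verbatim from the HodgeCMPerL package; no docstring in the source.) -/
instance : Nontrivial (H →L[ℂ] H) := by
  obtain ⟨x, hx⟩ := exists_ne (0 : H)
  exact nontrivial_of_ne 1 0 fun h => hx (by simpa using congrArg (fun T : H →L[ℂ] H => T x) h)

/-- Core step: a SELF-ADJOINT operator commuting with a topologically irreducible family has one-point
real spectrum. -/
theorem spectrum_subsingleton_of_commute {S : Set (H →L[ℂ] H)} (hS : TopIrreducible S)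
    (B : H →L[ℂ] H) (hB : IsSelfAdjoint B) (hc : ∀ s ∈ S, Commute s B) :
    (spectrum ℝ B).Subsingleton := by
  intro l hl m hm
  by_contra hne
  have hδ : 0 < |l - m| / 3 := by
    have : 0 < |l - m| := abs_pos.mpr (sub_ne_zero.mpr hne)
    linarith
  set f := tent l (|l - m| / 3) with hf_def
  set g := tent m (|l - m| / 3) with hg_def
  have hf : Continuous f := tent_continuous _ _
  have hg : Continuous g := tent_continuous _ _
  set F := cfc f B with hF_def
  set G := cfc g B with hG_def
  -- F, G commute with S, FG = GF = 0
  have hFc : ∀ s ∈ S, Commute s F := fun s hs => ((hc s hs).symm.cfc_real f).symm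
  have hFG : F * G = 0 := by
    rw [hF_def, hG_def, ← cfc_mul f g B hf.continuousOn hg.continuousOn]
    have h0 : (fun x => f x * g x) = 0 := by
      funext x
      exact tent_mul_tent l m x
    rw [h0, cfc_zero]
  have hGF : G * F = 0 := by rw [← (cfc_commute_cfc f g B).eq]; exact hFG
  -- F ≠ 0 and G ≠ 0 by the spectral mapping theorem
  have hne_zero : ∀ (k : ℝ → ℝ), Continuous k → ∀ a ∈ spectrum ℝ B, k a ≠ 0 → cfc k B ≠ 0 := by
    intro k hk a ha hka h0
    have hspec : spectrum ℝ (cfc k B) = k '' spectrum ℝ B := cfc_map_spectrum k B hB hk.continuousOn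
    have hmem : k a ∈ spectrum ℝ (cfc k B) := by rw [hspec]; exact ⟨a, ha, rfl⟩
    rw [h0, spectrum.zero_eq, Set.mem_singleton_iff] at hmem
    exact hka hmem
  have hF0 : F ≠ 0 := hne_zero f hf l hl (by rw [hf_def, tent_self l hδ.le]; exact hδ.ne')
  have hG0 : G ≠ 0 := hne_zero g hg m hm (by rw [hg_def, tent_self m hδ.le]; exact hδ.ne')
  -- the closed invariant subspace `closure (range F)`
  set K := (LinearMap.range F.toLinearMap).topologicalClosure with hK_def
  rcases hS K (Submodule.isClosed_topologicalClosure _) (invariant_closure_range F hFc) with hbot | htop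
  · apply hF0
    ext x
    have hx : F x ∈ K := Submodule.le_topologicalClosure _ ⟨x, rfl⟩
    rw [hbot, Submodule.mem_bot] at hx
    simpa using hx
  · apply hG0
    ext x
    have hx : x ∈ K := by rw [htop]; exact Submodule.mem_top
    have hker : (K : Set H) ⊆ (LinearMap.ker G.toLinearMap : Set H) := by
      rw [hK_def, Submodule.topologicalClosure_coe]
      apply closure_minimal _ (G.isClosed_ker)
      rintro _ ⟨y, rfl⟩
      have h := congrArg (fun T : H →L[ℂ] H => T y) hGF
      simpa using h
    simpa using hker hx

/-- Schur, self-adjoint form: a self-adjoint operator commuting with a topologically irreducible family is a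
REAL scalar. -/
theorem eq_algebraMap_of_commute_selfAdjoint {S : Set (H →L[ℂ] H)} (hS : TopIrreducible S)
    (B : H →L[ℂ] H) (hB : IsSelfAdjoint B) (hc : ∀ s ∈ S, Commute s B) :
    ∃ r : ℝ, B = algebraMap ℝ (H →L[ℂ] H) r := by
  obtain ⟨r, hr⟩ := ContinuousFunctionalCalculus.spectrum_nonempty (R := ℝ) B hB
  exact ⟨r, CFC.eq_algebraMap_of_spectrum_subset_singleton (R := ℝ) B r
    (fun x hx => Set.mem_singleton_iff.mpr (spectrum_subsingleton_of_commute hS B hB hc hx hr)) hB⟩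

omit [Nontrivial H] in
/-- **Schur's lemma (topological, Hilbert space).**  If `S` is closed under adjoints and topologically
irreducible, every bounded operator commuting with `S` is a scalar. -/
theorem eq_scalar_of_commute {S : Set (H →L[ℂ] H)} (hS : TopIrreducible S)
    (hstar : ∀ s ∈ S, star s ∈ S) (A : H →L[ℂ] H) (hc : ∀ s ∈ S, Commute s A) :
    ∃ c : ℂ, A = c • (1 : H →L[ℂ] H) := by
  rcases subsingleton_or_nontrivial H with hH | hH
  · refine ⟨0, ?_⟩
    ext x
    simp [Subsingleton.elim x 0]
  -- `A*` commutes with `S` because `S = S*`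
  have hcs : ∀ s ∈ S, Commute s (star A) := fun s hs => by
    have h := (hc (star s) (hstar s hs)).star_star
    rwa [star_star] at h
  -- self-adjoint parts
  set B₁ : H →L[ℂ] H := A + star A with hB₁_def
  set B₂ : H →L[ℂ] H := Complex.I • (star A - A) with hB₂_def
  have hB₁ : IsSelfAdjoint B₁ := by
    rw [IsSelfAdjoint, hB₁_def, star_add, star_star, add_comm]
  have hB₂ : IsSelfAdjoint B₂ := by
    rw [IsSelfAdjoint, hB₂_def, star_smul, star_sub, star_star, Complex.star_def, Complex.conj_I,
      neg_smul, ← smul_neg, neg_sub]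
  have hc₁ : ∀ s ∈ S, Commute s B₁ := fun s hs => (hc s hs).add_right (hcs s hs)
  have hc₂ : ∀ s ∈ S, Commute s B₂ := fun s hs => ((hcs s hs).sub_right (hc s hs)).smul_right _
  obtain ⟨r₁, h₁⟩ := eq_algebraMap_of_commute_selfAdjoint hS B₁ hB₁ hc₁
  obtain ⟨r₂, h₂⟩ := eq_algebraMap_of_commute_selfAdjoint hS B₂ hB₂ hc₂
  -- A = (B₁ + i B₂) / 2
  have hA : (2 : ℂ) • A = B₁ + Complex.I • B₂ := by
    rw [hB₁_def, hB₂_def, smul_smul, Complex.I_mul_I, neg_one_smul, neg_sub, two_smul]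
    abel
  refine ⟨(2 : ℂ)⁻¹ * ((r₁ : ℂ) + Complex.I * (r₂ : ℂ)), ?_⟩
  have h2 : A = (2 : ℂ)⁻¹ • ((2 : ℂ) • A) := by
    rw [smul_smul, inv_mul_cancel₀ (two_ne_zero), one_smul]
  rw [h2, hA, h₁, h₂, Algebra.algebraMap_eq_smul_one, Algebra.algebraMap_eq_smul_one, mul_smul,
    add_smul, mul_smul, ← Complex.coe_smul, ← Complex.coe_smul, smul_add]

end Operators

/-! ### Unitary representations and intertwiners -/

section Unitary

variable {G : Type*} [Group G]
variable {V : Type*} [NormedAddCommGroup V] [InnerProductSpace ℂ V] [CompleteSpace V]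
variable {W : Type*} [NormedAddCommGroup W] [InnerProductSpace ℂ W] [CompleteSpace W]

/-- The operator family of a unitary representation `ρ : G →* unitary (V →L[ℂ] V)`. -/
def ops (ρ : G →* unitary (V →L[ℂ] V)) : Set (V →L[ℂ] V) :=
  Set.range fun g => (ρ g : V →L[ℂ] V)

/-- (Ported verbatim from the HodgeCMPerL package; no docstring in the source.) -/
theorem coe_map_inv (ρ : G →* unitary (V →L[ℂ] V)) (g : G) :
    ((ρ g⁻¹ : unitary (V →L[ℂ] V)) : V →L[ℂ] V) = star (ρ g : V →L[ℂ] V) := by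
  rw [map_inv, ← Unitary.star_eq_inv, Unitary.coe_star]

/-- (Ported verbatim from the HodgeCMPerL package; no docstring in the source.) -/
theorem adjoint_coe (ρ : G →* unitary (V →L[ℂ] V)) (g : G) :
    adjoint (ρ g : V →L[ℂ] V) = (ρ g⁻¹ : unitary (V →L[ℂ] V)) := by
  rw [← star_eq_adjoint, coe_map_inv]

/-- The operator family of a unitary representation is closed under adjoints. -/
theorem star_mem_ops (ρ : G →* unitary (V →L[ℂ] V)) : ∀ s ∈ ops ρ, star s ∈ ops ρ := by
  rintro _ ⟨g, rfl⟩
  exact ⟨g⁻¹, coe_map_inv ρ g⟩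

/-- A unitary representation is (topologically) **irreducible** when its operator family is. -/
def Irreducible (ρ : G →* unitary (V →L[ℂ] V)) : Prop := TopIrreducible (ops ρ)

/-- `T` intertwines `ρ` and `σ`. -/
def Intertwines (ρ : G →* unitary (V →L[ℂ] V)) (σ : G →* unitary (W →L[ℂ] W)) (T : V →L[ℂ] W) :
    Prop :=
  ∀ g : G, T ∘L (ρ g : V →L[ℂ] V) = (σ g : W →L[ℂ] W) ∘L T

variable {ρ : G →* unitary (V →L[ℂ] V)} {σ : G →* unitary (W →L[ℂ] W)} {T : V →L[ℂ] W}

/-- The adjoint of an intertwiner of UNITARY representations intertwines the other way. -/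
theorem Intertwines.adjoint_intertwines (hT : Intertwines ρ σ T) :
    Intertwines σ ρ (ContinuousLinearMap.adjoint T) := by
  intro g
  have h := congrArg ContinuousLinearMap.adjoint (hT g⁻¹)
  rw [adjoint_comp, adjoint_comp, adjoint_coe ρ, adjoint_coe σ, inv_inv] at h
  exact h.symm

/-- `T† T` commutes with `ρ`. -/
theorem Intertwines.commute_adjoint_comp (hT : Intertwines ρ σ T) (g : G) :
    Commute (ρ g : V →L[ℂ] V) (ContinuousLinearMap.adjoint T ∘L T) := by
  change (ρ g : V →L[ℂ] V) * (ContinuousLinearMap.adjoint T ∘L T) =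
    (ContinuousLinearMap.adjoint T ∘L T) * (ρ g : V →L[ℂ] V)
  rw [mul_def, mul_def, ← comp_assoc, ← Intertwines.adjoint_intertwines hT g, comp_assoc, ← hT g,
    ← comp_assoc]

/-- **Schur for intertwiners, metric form.**  A bounded intertwiner out of an IRREDUCIBLE unitary
representation is a scalar multiple of an isometry: `‖T x‖² = c ‖x‖²` with `c ≥ 0`. -/
theorem norm_sq_eq_of_intertwiner (hρ : Irreducible ρ) (hT : Intertwines ρ σ T) :
    ∃ c : ℝ, 0 ≤ c ∧ ∀ x : V, ‖T x‖ ^ 2 = c * ‖x‖ ^ 2 := by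
  obtain ⟨c, hc⟩ := eq_scalar_of_commute hρ (star_mem_ops ρ) (ContinuousLinearMap.adjoint T ∘L T)
    (by rintro _ ⟨g, rfl⟩; exact Intertwines.commute_adjoint_comp hT g)
  have key : ∀ x : V, ‖T x‖ ^ 2 = c.re * ‖x‖ ^ 2 := by
    intro x
    have h1 : (c • (1 : V →L[ℂ] V)) x = c • x := rfl
    rw [apply_norm_sq_eq_inner_adjoint_left, hc, h1, inner_smul_left, inner_self_eq_norm_sq_to_K]
    simp only [RCLike.mul_re, RCLike.conj_re, RCLike.conj_im]
    norm_cast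
    simp
  rcases subsingleton_or_nontrivial V with hV | hV
  · exact ⟨0, le_rfl, fun x => by simp [Subsingleton.elim x 0]⟩
  · obtain ⟨x₀, hx₀⟩ := exists_ne (0 : V)
    refine ⟨c.re, ?_, key⟩
    have h0 : 0 < ‖x₀‖ ^ 2 := by positivity
    have h1 : 0 ≤ ‖T x₀‖ ^ 2 := by positivity
    rw [key x₀] at h1
    exact nonneg_of_mul_nonneg_left h1 h0

/-- From `T ≠ 0` the constant is positive and `T / √c` is an equivariant isometry. -/
theorem exists_linearIsometry_of_intertwiner_ne_zero (hρ : Irreducible ρ) (hT : Intertwines ρ σ T)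
    (hT0 : T ≠ 0) :
    ∃ U : V →ₗᵢ[ℂ] W, (∃ a : ℝ, 0 < a ∧ ∀ x, U x = (a : ℂ) • T x) ∧
      ∀ (g : G) (x : V), U ((ρ g : V →L[ℂ] V) x) = (σ g : W →L[ℂ] W) (U x) := by
  obtain ⟨c, hc0, hc⟩ := norm_sq_eq_of_intertwiner hρ hT
  have hcpos : 0 < c := by
    rcases hc0.lt_or_eq with h | h
    · exact h
    · exfalso
      apply hT0
      ext x
      have hx := hc x
      rw [← h, zero_mul, sq_eq_zero_iff, norm_eq_zero] at hx
      simpa using hx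
  have hsq : 0 < Real.sqrt c := Real.sqrt_pos.mpr hcpos
  set a : ℝ := (Real.sqrt c)⁻¹ with ha_def
  have ha : 0 < a := inv_pos.mpr hsq
  have hnormT : ∀ x, ‖T x‖ = Real.sqrt c * ‖x‖ := by
    intro x
    have h1 : ‖T x‖ = Real.sqrt (‖T x‖ ^ 2) := (Real.sqrt_sq (norm_nonneg _)).symm
    rw [h1, hc x, Real.sqrt_mul hc0, Real.sqrt_sq (norm_nonneg _)]
  let U : V →ₗᵢ[ℂ] W :=
    { toLinearMap := (a : ℂ) • T.toLinearMap
      norm_map' := by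
        intro x
        simp only [LinearMap.smul_apply, ContinuousLinearMap.coe_coe, norm_smul, Complex.norm_real,
          Real.norm_eq_abs, hnormT x, ha_def, abs_inv, abs_of_pos hsq]
        rw [← mul_assoc, inv_mul_cancel₀ hsq.ne', one_mul] }
  refine ⟨U, ⟨a, ha, fun x => rfl⟩, fun g x => ?_⟩
  show (a : ℂ) • T ((ρ g : V →L[ℂ] V) x) = (σ g : W →L[ℂ] W) ((a : ℂ) • T x)
  rw [ContinuousLinearMap.map_smul]
  congr 1
  have h := congrArg (fun S : V →L[ℂ] W => S x) (hT g)
  simpa using h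

/-- **An irreducible unitary representation mapping non-trivially into a unitary representation `σ` is a
constituent of `σ`:** it is unitarily equivalent to a closed `σ`-invariant subspace (the closure is automatic —
the image of an isometry from a complete space is closed). -/
theorem exists_isometry_of_intertwiner_ne_zero (hρ : Irreducible ρ) (hT : Intertwines ρ σ T)
    (hT0 : T ≠ 0) :
    ∃ U : V →ₗᵢ[ℂ] W, IsClosed (Set.range U) ∧
      (∀ (g : G) (y : W), y ∈ Set.range U → (σ g : W →L[ℂ] W) y ∈ Set.range U) ∧
      ∀ (g : G) (x : V), U ((ρ g : V →L[ℂ] V) x) = (σ g : W →L[ℂ] W) (U x) := by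
  obtain ⟨U, -, hU⟩ := exists_linearIsometry_of_intertwiner_ne_zero hρ hT hT0
  refine ⟨U, U.isometry.isClosedEmbedding.isClosed_range, ?_, hU⟩
  rintro g _ ⟨x, rfl⟩
  exact ⟨(ρ g : V →L[ℂ] V) x, hU g x⟩

/-- **Schur for intertwiners, equivalence form.**  A non-zero bounded intertwiner between IRREDUCIBLE unitary
representations is a scalar multiple of a unitary equivalence; in particular the two representations are
unitarily equivalent. -/
theorem exists_equiv_of_intertwiner_ne_zero (hρ : Irreducible ρ) (hσ : Irreducible σ)
    (hT : Intertwines ρ σ T) (hT0 : T ≠ 0) :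
    ∃ U : V ≃ₗᵢ[ℂ] W, (∃ a : ℝ, 0 < a ∧ ∀ x, U x = (a : ℂ) • T x) ∧
      ∀ (g : G) (x : V), U ((ρ g : V →L[ℂ] V) x) = (σ g : W →L[ℂ] W) (U x) := by
  obtain ⟨U, ⟨a, ha, hUa⟩, hU⟩ := exists_linearIsometry_of_intertwiner_ne_zero hρ hT hT0
  -- the range of U is a closed σ-invariant subspace of W, non-zero, hence everything
  set K : Submodule ℂ W := LinearMap.range U.toLinearMap with hK_def
  have hKclosed : IsClosed (K : Set W) := by
    have h : (K : Set W) = Set.range U := by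
      ext y
      simp [hK_def]
    rw [h]
    exact U.isometry.isClosedEmbedding.isClosed_range
  have hKinv : Invariant (ops σ) K := by
    rintro _ ⟨g, rfl⟩ _ ⟨x, rfl⟩
    exact ⟨(ρ g : V →L[ℂ] V) x, hU g x⟩
  have hKtop : K = ⊤ := by
    rcases hσ K hKclosed hKinv with hbot | htop
    · exfalso
      apply hT0
      ext x
      have hx : U x ∈ K := ⟨x, rfl⟩
      rw [hbot, Submodule.mem_bot, hUa x, smul_eq_zero] at hx
      rcases hx with h | h
      · exact absurd (by exact_mod_cast h : a = 0) ha.ne'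
      · simpa using h
    · exact htop
  have hsurj : Function.Surjective U := by
    intro y
    have hy : y ∈ K := by rw [hKtop]; exact Submodule.mem_top
    obtain ⟨x, hx⟩ := hy
    exact ⟨x, hx⟩
  refine ⟨LinearIsometryEquiv.ofSurjective U hsurj, ⟨a, ha, fun x => ?_⟩, fun g x => ?_⟩
  · simp [hUa x]
  · simpa using hU g x

end Unitary

end Schur
end PerL34
end HodgeCM

end
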